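import Summits.QuantumFields.YangMills.Theorems.RationalShortRootRigidityLagrangeAlternation
import Summits.QuantumFields.YangMills.Theorems.RationalShortRootRigidityHyperplaneVanishing
import HarnessLib

/-!
# `RationalShortRootRigidity` — Step 4 helper (m17): the shell residue signs

Helper lemma INSIDE the paper proof of crux `stmt-QuantumFields-23124` (`F4SubCurvatureDoor.RationalShortRootRigidity`,
LINE g15-A of planner ym-idea-3; Step (4a); free-hands menu V, item (m17), statement typed in HOME l15/Helpers23124d.lean as
`Helpers.ShellResidueSign` — proved here DEF-FREE, with `AxisStieltjes'` unfolded and the route's `sqLift M = aeval (p₀ ↦ p₀², q ↦ q) M`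
written out):

**Lemma** (`shellResidueSign`).  Let `D₀ = c·∏ⱼ (p² + μⱼ)` with `μ₀ < μ₁ < ⋯` and `c ≠ 0`, `N₀ = M(p₀², q)`, and suppose `N₀/D₀` is
axis-Stieltjes: `N₀(t,q) = D₀(t,q)·(c_q(t²) + Σₗ rₗ/(t² + ωₗ²))`, `ωₗ > 0`, `rₗ ≥ 0`, for every `q ≠ 0` and all real `t`.  Then
`c·(−1)ʲ·M(−μⱼ − |q|², q) ≥ 0` for every `q ≠ 0` and every shell `j`.

Proof.  Fix `q ≠ 0`, `a = |q|² + μⱼ`.  If `a ≤ 0` the shell value `u = −a ≥ 0` is attained by a real `t`, where `D₀` vanishes and the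
Stieltjes factor is finite, so `M(−a, q) = 0`.  If `a > 0`, clear only the NON-resonant denominators `∏_{ωₗ² ≠ a}(u + ωₗ²)`: the identity
of real polynomials in `u = t²` holds on `[0, ∞)`, hence identically (`Polynomial.eq_of_infinite_eval_eq`), and at `u = −a` it reads
`M(−a, q)·Π = c·∏_{i ≠ j}(μᵢ − μⱼ)·(Σ_{ωₗ² = a} rₗ)·Π` with `Π ≠ 0`; the sign of `∏_{i≠j}(μᵢ − μⱼ)` is `(−1)ʲ`
(`prod_erase_eq_sign_mul`, p662301).

Mathlib + tree helpers (`prod_erase_eq_sign_mul`, `eval_bind₁_gen`); THEOREMS ONLY (no definitions); no named facts; no `sorry`;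
default heartbeats.  Nothing about the crux 23124, the route's rung or the Yang–Mills mass gap is proved here.  Free-hands seat
`ym-line-frs-p2` g10 (owner's arbitration 2026-08-28T21:22Z), `--supports stmt-QuantumFields-23124`.
-/

set_option autoImplicit false

namespace Summit.QuantumFields.YangMills.Theorems.RationalShortRootRigidity

open Polynomial
open scoped BigOperators Polynomial

/-- Evaluation of the lift `M(p₀², q)` on a fibre. [folklore] -/
theorem eval_sqLift_cons (M : MvPolynomial (Fin 4) ℝ) (t : ℝ) (q : Fin 3 → ℝ) :
    MvPolynomial.eval (Fin.cons t q : Fin 4 → ℝ)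
      (MvPolynomial.aeval (fun i : Fin 4 => if i = 0 then (MvPolynomial.X 0 : MvPolynomial (Fin 4) ℝ) ^ 2
        else MvPolynomial.X i) M) =
      MvPolynomial.eval (Fin.cons (t ^ 2) q : Fin 4 → ℝ) M := by
  rw [show MvPolynomial.aeval (fun i : Fin 4 => if i = 0 then (MvPolynomial.X 0 : MvPolynomial (Fin 4) ℝ) ^ 2
      else MvPolynomial.X i) M = MvPolynomial.bind₁ (fun i : Fin 4 => if i = 0 then
        (MvPolynomial.X 0 : MvPolynomial (Fin 4) ℝ) ^ 2 else MvPolynomial.X i) M from rfl, eval_bind₁_gen]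
  have hpt : (fun i : Fin 4 => MvPolynomial.eval (Fin.cons t q : Fin 4 → ℝ)
      (if i = 0 then (MvPolynomial.X 0 : MvPolynomial (Fin 4) ℝ) ^ 2 else MvPolynomial.X i)) =
      (Fin.cons (t ^ 2) q : Fin 4 → ℝ) := by
    funext i
    refine Fin.cases ?_ (fun l => ?_) i
    · simp only [if_true, map_pow, MvPolynomial.eval_X, Fin.cons_zero]
    · simp only [Fin.succ_ne_zero, if_false, MvPolynomial.eval_X, Fin.cons_succ]
  rw [hpt]

/-- The sign of `∏_{i ≠ j}(μᵢ − μⱼ)` for increasing shells is `(−1)ʲ`. [folklore] -/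
theorem sign_prod_shell {k : ℕ} (μ : Fin k → ℝ) (hμ : StrictMono μ) (j : Fin k) :
    0 ≤ (-1 : ℝ) ^ (j : ℕ) * ∏ i ∈ Finset.univ.erase j, (μ i - μ j) := by
  classical
  have h1 : ∏ i ∈ Finset.univ.erase j, (μ i - μ j) = (-1) ^ (k - 1) * ∏ i ∈ Finset.univ.erase j, (μ j - μ i) := by
    have h2 : ∏ i ∈ Finset.univ.erase j, (μ i - μ j) =
        (-1) ^ (Finset.univ.erase j).card * ∏ i ∈ Finset.univ.erase j, (μ j - μ i) := by
      rw [← Finset.prod_neg]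
      exact Finset.prod_congr rfl fun i _ => by ring
    rw [h2, Finset.card_erase_of_mem (Finset.mem_univ j), Finset.card_univ, Fintype.card_fin]
  rw [h1, prod_erase_eq_sign_mul μ hμ j]
  have hj : (j : ℕ) < k := j.isLt
  have hpow : (-1 : ℝ) ^ (j : ℕ) * ((-1) ^ (k - 1) * ((-1) ^ (k - 1 - (j : ℕ)))) = 1 := by
    rw [← pow_add, ← pow_add, show (j : ℕ) + (k - 1 + (k - 1 - (j : ℕ))) = 2 * (k - 1) by omega, pow_mul]
    norm_num
  calc (0 : ℝ) ≤ ∏ i ∈ Finset.univ.erase j, |μ j - μ i| := Finset.prod_nonneg fun i _ => abs_nonneg _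
    _ = (-1 : ℝ) ^ (j : ℕ) * ((-1) ^ (k - 1) * ((-1) ^ (k - 1 - (j : ℕ)) * ∏ i ∈ Finset.univ.erase j, |μ j - μ i|)) := by
      rw [← mul_assoc ((-1 : ℝ) ^ (k - 1)), ← mul_assoc, hpow, one_mul]

/-- **Shell residue signs** (m17; Step (4a) of the paper proof of 23124).  The statement is the body of `Helpers.ShellResidueSign`
(HOME l15/Helpers23124d.lean) with `AxisStieltjes'` and `sqLift` unfolded. [folklore] -/
theorem shellResidueSign :
    ∀ (k : ℕ) (μ : Fin k → ℝ) (c : ℝ) (M D₀ : MvPolynomial (Fin 4) ℝ), StrictMono μ → c ≠ 0 →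
      D₀ = MvPolynomial.C c * ∏ j, ((∑ i, MvPolynomial.X i ^ 2) + MvPolynomial.C (μ j)) →
      (∀ q : Fin 3 → ℝ, q ≠ 0 → ∃ (K : ℕ) (ω r : Fin K → ℝ) (cp : Polynomial ℝ),
        (∀ l, 0 < ω l) ∧ (∀ l, 0 ≤ r l) ∧
        ∀ t : ℝ, MvPolynomial.eval (Fin.cons t q)
            (MvPolynomial.aeval (fun i : Fin 4 => if i = 0 then (MvPolynomial.X 0 : MvPolynomial (Fin 4) ℝ) ^ 2
              else MvPolynomial.X i) M) =
          MvPolynomial.eval (Fin.cons t q) D₀ * (cp.eval (t ^ 2) + ∑ l, r l / (t ^ 2 + ω l ^ 2))) →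
      ∀ q : Fin 3 → ℝ, q ≠ 0 → ∀ j : Fin k,
        0 ≤ c * (-1) ^ (j : ℕ) * MvPolynomial.eval (Fin.cons (-(μ j) - ∑ i, q i ^ 2) q) M := by
  intro k μ c M D₀ hμ hc hD hAS q hq j
  classical
  obtain ⟨K, ω, r, cp, hω, hr, hid⟩ := hAS q hq
  set Q : ℝ := ∑ i, q i ^ 2 with hQ
  set a : ℝ := Q + μ j with ha
  -- evaluations of `N₀` and `D₀` on the fibre
  have hD_eval : ∀ t : ℝ, MvPolynomial.eval (Fin.cons t q : Fin 4 → ℝ) D₀ = c * ∏ i, (t ^ 2 + Q + μ i) := by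
    intro t
    rw [hD, map_mul, MvPolynomial.eval_C, map_prod]
    congr 1
    refine Finset.prod_congr rfl fun i _ => ?_
    rw [map_add, MvPolynomial.eval_C, map_sum, Fin.sum_univ_succ]
    simp only [map_pow, MvPolynomial.eval_X, Fin.cons_zero, Fin.cons_succ, hQ]
  have hid' : ∀ t : ℝ, MvPolynomial.eval (Fin.cons (t ^ 2) q : Fin 4 → ℝ) M =
      c * (∏ i, (t ^ 2 + Q + μ i)) * (cp.eval (t ^ 2) + ∑ l, r l / (t ^ 2 + ω l ^ 2)) := by
    intro t; rw [← eval_sqLift_cons, hid t, hD_eval]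
  have htarget : -(μ j) - ∑ i, q i ^ 2 = -a := by rw [ha, hQ]; ring
  rw [htarget]
  rcases le_or_gt a 0 with ha0 | ha0
  · -- degenerate shell: the value `u = −a ≥ 0` is a real `t²`, where `D₀` vanishes
    have ht : MvPolynomial.eval (Fin.cons (-a) q : Fin 4 → ℝ) M = 0 := by
      have h1 := hid' (Real.sqrt (-a))
      rw [Real.sq_sqrt (by linarith)] at h1
      rw [h1]
      have : ∏ i, (-a + Q + μ i) = 0 :=
        Finset.prod_eq_zero (Finset.mem_univ j) (by rw [ha]; ring)
      rw [this, mul_zero, zero_mul]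
    rw [ht, mul_zero]
  · -- generic shell: polynomial identity in `u = t²` with the non-resonant denominators cleared
    set L : Finset (Fin K) := Finset.univ.filter (fun l => ω l ^ 2 = a) with hL
    set Lc : Finset (Fin K) := Finset.univ.filter (fun l => ¬ ω l ^ 2 = a) with hLc
    set SL : ℝ := ∑ l ∈ L, r l with hSL
    -- fibre polynomial of `M`
    set Mq : ℝ[X] := Polynomial.map (MvPolynomial.eval q) (MvPolynomial.finSuccEquiv ℝ 3 M) with hMq
    have hMq_eval : ∀ u : ℝ, Mq.eval u = MvPolynomial.eval (Fin.cons u q : Fin 4 → ℝ) M :=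
      fun u => (MvPolynomial.eval_eq_eval_mv_eval' q u M).symm
    -- the two polynomials
    set Pc : ℝ[X] := ∏ l ∈ Lc, (X + C (ω l ^ 2)) with hPc
    set Pl : Fin K → ℝ[X] := fun l => ∏ l' ∈ Lc.erase l, (X + C (ω l' ^ 2)) with hPl
    set P' : ℝ[X] := ∏ i ∈ Finset.univ.erase j, (X + C (Q + μ i)) with hP'
    set LHS : ℝ[X] := Mq * Pc with hLHS
    set RHS : ℝ[X] := C c * P' * ((X + C a) * (cp * Pc + ∑ l ∈ Lc, C (r l) * Pl l) + C SL * Pc) with hRHS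
    -- the identity on `[0, ∞)`
    have hreal : ∀ T : ℝ, 0 ≤ T → LHS.eval T = RHS.eval T := by
      intro T hT
      obtain ⟨t, rfl⟩ : ∃ t : ℝ, T = t ^ 2 := ⟨Real.sqrt T, (Real.sq_sqrt hT).symm⟩
      have hTa : t ^ 2 + a ≠ 0 := by positivity
      have hden : ∀ l, t ^ 2 + ω l ^ 2 ≠ 0 := fun l => by have := hω l; positivity
      -- real values of the polynomial pieces
      have ePc : Pc.eval (t ^ 2) = ∏ l ∈ Lc, (t ^ 2 + ω l ^ 2) := by
        rw [hPc, eval_prod]; refine Finset.prod_congr rfl fun l _ => by rw [eval_add, eval_X, eval_C]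
      have ePl : ∀ l, (Pl l).eval (t ^ 2) = ∏ l' ∈ Lc.erase l, (t ^ 2 + ω l' ^ 2) := by
        intro l; rw [hPl]; simp only []; rw [eval_prod]
        refine Finset.prod_congr rfl fun l' _ => by rw [eval_add, eval_X, eval_C]
      have eP' : P'.eval (t ^ 2) = ∏ i ∈ Finset.univ.erase j, (t ^ 2 + Q + μ i) := by
        rw [hP', eval_prod]; refine Finset.prod_congr rfl fun i _ => by rw [eval_add, eval_X, eval_C, add_assoc]
      -- splitting the Stieltjes sum into resonant and non-resonant parts
      have hsplit : (∑ l, r l / (t ^ 2 + ω l ^ 2)) = SL / (t ^ 2 + a) + ∑ l ∈ Lc, r l / (t ^ 2 + ω l ^ 2) := by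
        rw [← Finset.sum_filter_add_sum_filter_not Finset.univ (fun l => ω l ^ 2 = a), ← hL, ← hLc, hSL,
          Finset.sum_div]
        congr 1
        refine Finset.sum_congr rfl fun l hl => ?_
        rw [(Finset.mem_filter.1 hl).2]
      have hSc : (∑ l ∈ Lc, r l / (t ^ 2 + ω l ^ 2)) * ∏ l ∈ Lc, (t ^ 2 + ω l ^ 2) =
          ∑ l ∈ Lc, r l * ∏ l' ∈ Lc.erase l, (t ^ 2 + ω l' ^ 2) := by
        rw [Finset.sum_mul]
        refine Finset.sum_congr rfl fun l hl => ?_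
        rw [← Finset.mul_prod_erase Lc (fun l' => t ^ 2 + ω l' ^ 2) hl, ← mul_assoc, div_mul_cancel₀ _ (hden l)]
      have hprodj : ∏ i, (t ^ 2 + Q + μ i) = (t ^ 2 + a) * ∏ i ∈ Finset.univ.erase j, (t ^ 2 + Q + μ i) := by
        rw [← Finset.mul_prod_erase Finset.univ (fun i => t ^ 2 + Q + μ i) (Finset.mem_univ j), ha, add_assoc]
      -- assemble
      rw [hLHS, hRHS, eval_mul, hMq_eval, hid' t, hsplit, hprodj, ePc]
      simp only [eval_mul, eval_add, eval_C, eval_X, eval_finsetSum, ePl, eP', ePc]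
      have e1 : (t ^ 2 + a) * (SL / (t ^ 2 + a)) = SL := mul_div_cancel₀ _ hTa
      calc c * ((t ^ 2 + a) * ∏ i ∈ Finset.univ.erase j, (t ^ 2 + Q + μ i)) *
            (cp.eval (t ^ 2) + (SL / (t ^ 2 + a) + ∑ l ∈ Lc, r l / (t ^ 2 + ω l ^ 2))) *
            ∏ l ∈ Lc, (t ^ 2 + ω l ^ 2)
          = c * (∏ i ∈ Finset.univ.erase j, (t ^ 2 + Q + μ i)) *
              ((t ^ 2 + a) * (cp.eval (t ^ 2) * ∏ l ∈ Lc, (t ^ 2 + ω l ^ 2) +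
                (∑ l ∈ Lc, r l / (t ^ 2 + ω l ^ 2)) * ∏ l ∈ Lc, (t ^ 2 + ω l ^ 2)) +
              ((t ^ 2 + a) * (SL / (t ^ 2 + a))) * ∏ l ∈ Lc, (t ^ 2 + ω l ^ 2)) := by ring
        _ = _ := by rw [e1, hSc]
    -- hence the identity of polynomials
    have hpoly : LHS = RHS := by
      apply Polynomial.eq_of_infinite_eval_eq
      exact (Set.Ici_infinite (0 : ℝ)).mono fun T hT => hreal T hT
    -- evaluate at `u = −a`
    have hPc0 : Pc.eval (-a) ≠ 0 := by
      rw [hPc, eval_prod]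
      refine Finset.prod_ne_zero_iff.2 fun l hl => ?_
      rw [eval_add, eval_X, eval_C]
      have := (Finset.mem_filter.1 hl).2
      intro h; apply this; linarith
    have heval := congrArg (fun P : ℝ[X] => P.eval (-a)) hpoly
    simp only [hLHS, hRHS, eval_mul, eval_add, eval_C, eval_X, neg_add_cancel, zero_mul, zero_add, hMq_eval] at heval
    have hP'a : P'.eval (-a) = ∏ i ∈ Finset.univ.erase j, (μ i - μ j) := by
      rw [hP', eval_prod]; refine Finset.prod_congr rfl fun i _ => by rw [eval_add, eval_X, eval_C, ha]; ring
    rw [hP'a] at heval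
    have hM : MvPolynomial.eval (Fin.cons (-a) q : Fin 4 → ℝ) M = c * (∏ i ∈ Finset.univ.erase j, (μ i - μ j)) * SL :=
      mul_right_cancel₀ hPc0 (by rw [heval]; ring)
    rw [hM]
    have hSL0 : 0 ≤ SL := Finset.sum_nonneg fun l _ => hr l
    have hsign := sign_prod_shell μ hμ j
    calc (0 : ℝ) ≤ (c * c) * ((-1 : ℝ) ^ (j : ℕ) * ∏ i ∈ Finset.univ.erase j, (μ i - μ j)) * SL :=
        mul_nonneg (mul_nonneg (mul_self_nonneg c) hsign) hSL0
      _ = c * (-1) ^ (j : ℕ) * (c * (∏ i ∈ Finset.univ.erase j, (μ i - μ j)) * SL) := by ring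

end Summit.QuantumFields.YangMills.Theorems.RationalShortRootRigidity
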